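import Summits.ValiantsHypothesis.ValiantsHypothesis.Theorems.GrenetZeonDualUnipotentThreeHalvesHeavyTopThmCIdentities
import Summits.ValiantsHypothesis.ValiantsHypothesis.Theorems.GrenetZeonDualUnipotentThreeHalvesHeavyTopThmCLinAlg

/-!
# `GrenetZeon.DualUnipotentThreeHalves` (stmt-ValiantsHypothesis-24318), R2 heavy-top instrument — UNIFORM THEOREM C, FILE 5:
# LEMMA R-b / THEOREM A (`h⋆ = 2s`): the lowest-weight piece is the line `ℂ(e_a − e_{a+s})`, and for `s ≥ 2` this is impossible

Experiment cell «val-heavytop-census» (D-0160), engine seat val-htc-eng-1 g5.  Frame as in `…ThmCLemmaRa` (graded nilpotent `W ∋ J`, `P_h`, `N_h`, lowest weight `s`;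
this file is independent of it).
When the deficient height is `2s` and `P_{2s} = u^⊥` is a hyperplane:

* ★ `shape` — (i) `q ↦ (q_i q_{i+s})_i` maps `N_s` into `ℂu` ((T3) on `u^⊥`) and is injective on lines (THEOREM B), so `dim N_s = 1`; (ii) for the generator `y₀`,
  `P_s = y₀^⊥`, and the second-order identity ✓ `sum_sq_add_two_mul_sum_eq_zero` at the test vector `x = e_{i₁}/y₀(i₁) − e_{i₂}/y₀(i₂)` shows that two support
  indices of `y₀` differ by exactly `s`; with the zero sum, `N_s = ℂ(e_a − e_{a+s})`.  (This replaces the memo's one-class / runs / `e₂^{na}` steps (ii)–(iii) and needs no cubes.)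
* ★ `kill` — for `s ≥ 2`: the window vector of `e_a − e_{a+s}` is `C = 𝟙_{[a,a+s)} − 𝟙_{[a+s,a+2s)} ∈ N_1` (T1), and the mixed word (T2) at `i = a+s−1` reads `−1 = 0`.
  (For `s = 1` the shape is THEOREM A's `L_1 = ℂ(e_a − e_{a+1})`, which the assembly turns into an invariant flag piece.)

Honest framing: infrastructure for the uniform Thm C; nothing here proves or refutes `HeavyTopLaw`/`HeavyTopSlowLaw`, 24318, S3 or 8062; `VP ≠ VNP` is NOT proved.
No definitions.  [val-idea-30 MEMO codim-one THEOREM A, §3 LEMMA R-b; this seat]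
-/

noncomputable section

-- single-conjunct layout: Sub = Summit, duplicated namespace component intended
set_option linter.dupNamespace false

namespace Summit.ValiantsHypothesis.ValiantsHypothesis.Theorems.GrenetZeon.HeavyTopThmCLemmaRb

open Matrix
open Summit.ValiantsHypothesis.ValiantsHypothesis.Theorems.GrenetZeon.HeavyTopThmCBandCalculus
  (pair_eq_zero_of_isNilpotent_band sum_sq_add_two_mul_sum_eq_zero)
open Summit.ValiantsHypothesis.ValiantsHypothesis.Theorems.GrenetZeon.HeavyTopThmCIdentities
  (upper_band_mem sum_mul_sq_eq_zero window_lower_mem mixed_word sum_ite_eq_val)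
open Summit.ValiantsHypothesis.ValiantsHypothesis.Theorems.GrenetZeon.HeavyTopThmCnStructure (lower_band_mem)
open Summit.ValiantsHypothesis.ValiantsHypothesis.Theorems.GrenetZeon.HeavyTopThmCnGradedCount (sum_dite_eq_sum_fin)
open Summit.ValiantsHypothesis.ValiantsHypothesis.Theorems.GrenetZeon.HeavyTopThmCStructure (mem_of_dot_eq_zero)
open Summit.ValiantsHypothesis.ValiantsHypothesis.Theorems.GrenetZeon.HeavyTopThmCLinAlg (exists_smul_of_forall_dot exists_ne_zero_of_two_le_finrank)

variable {n : ℕ}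

/-! ## The shape of `N_s` when `h⋆ = 2s` -/

/-- ★ **LEMMA R-b (i)–(iii) / THEOREM A (i)–(ii), kernel form.**  Frame: graded nilpotent `W` with `J^s ∈ W` (`s ≥ 1`, `2s < n`); at height `s`: `N_s ⊥ P_s`
with zero slack and zero sums; `P_{2s} = u^⊥` for some `u ≠ 0`; `N_s ≠ 0`.  Then `N_s` is the line spanned by `e_a − e_{a+s}` for some `a` with `a + 2s < n`.
[memo THEOREM A (i)–(ii), §3 (i)–(iii); this seat (two-support argument)] -/
theorem shape (W : Submodule ℂ (Matrix (Fin n) (Fin n) ℂ)) (hW : ∀ A ∈ W, IsNilpotent A)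
    (hgr : ∀ A ∈ W, ∀ d : ℤ, (Matrix.of fun a b : Fin n => if (b : ℤ) - (a : ℤ) = d then A a b else 0) ∈ W)
    (dp dm : ∀ h : ℕ, Matrix (Fin n) (Fin n) ℂ →ₗ[ℂ] (Fin (n - h) → ℂ))
    (hdp : ∀ h A (i : Fin (n - h)) (a b : Fin n), (a : ℕ) = i → (b : ℕ) = i + h → dp h A i = A a b)
    (hdm : ∀ h A (i : Fin (n - h)) (a b : Fin n), (a : ℕ) = i + h → (b : ℕ) = i → dm h A i = A a b)
    {s : ℕ} (hs : 1 ≤ s) (h2s : 2 * s < n)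
    (hJs : (Matrix.of fun a b : Fin n => if (b : ℕ) = (a : ℕ) + s then (1 : ℂ) else 0) ∈ W)
    (hPNs : ∀ q ∈ W.map (dm s), ∀ p ∈ W.map (dp s), q ⬝ᵥ p = 0)
    (gsums : Module.finrank ℂ (W.map (dp s)) + Module.finrank ℂ (W.map (dm s)) = n - s)
    (hN1s : ∀ q ∈ W.map (dm s), q ⬝ᵥ (fun _ => (1 : ℂ)) = 0)
    (u : Fin (n - 2 * s) → ℂ) (hu0 : u ≠ 0) (hPu : ∀ x, x ∈ W.map (dp (2 * s)) ↔ u ⬝ᵥ x = 0)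
    (hne : W.map (dm s) ≠ ⊥) :
    ∃ (a : ℕ) (ha : a + 2 * s < n),
      (Pi.single (⟨a, by omega⟩ : Fin (n - s)) (1 : ℂ) - Pi.single (⟨a + s, by omega⟩ : Fin (n - s)) (1 : ℂ)) ∈ W.map (dm s) ∧
      ∀ q ∈ W.map (dm s), ∃ t : ℂ, q = t • (Pi.single (⟨a, by omega⟩ : Fin (n - s)) (1 : ℂ) - Pi.single (⟨a + s, by omega⟩ : Fin (n - s)) (1 : ℂ)) := by
  classical
  -- extensions of vectors to `Fin n` and the bands they define
  have ext_dm : ∀ B ∈ W, (Matrix.of fun a b : Fin n => if (a : ℕ) = (b : ℕ) + s then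
      (fun i : Fin n => if hi : (i : ℕ) < n - s then dm s B ⟨(i : ℕ), hi⟩ else 0) b else 0) ∈ W :=
    fun B hB => lower_band_mem W hgr s (dm s) (hdm s) B hB _ (fun i => by simp only [dif_pos (show (i : ℕ) < n - s from i.isLt)])
  have ext_dp : ∀ h, ∀ A ∈ W, (Matrix.of fun a b : Fin n => if (b : ℕ) = (a : ℕ) + h then
      (fun i : Fin n => if hi : (i : ℕ) < n - h then dp h A ⟨(i : ℕ), hi⟩ else 0) a else 0) ∈ W :=
    fun h A hA => upper_band_mem W hgr h (dp h) (hdp h) A hA _ (fun i => by simp only [dif_pos (show (i : ℕ) < n - h from i.isLt)])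
  -- (i) `Q(q) := (q_{i+s} q_i)_i ∈ ℂu`
  have hQu : ∀ q ∈ W.map (dm s), ∃ t : ℂ, (fun i : Fin (n - 2 * s) => q ⟨(i : ℕ) + s, by omega⟩ * q ⟨(i : ℕ), by omega⟩) = t • u := by
    rintro _ ⟨B, hB, rfl⟩
    refine exists_smul_of_forall_dot u _ fun x hx => ?_
    obtain ⟨A, hA, rfl⟩ := (hPu x).2 hx
    have h := sum_mul_sq_eq_zero W hW s _ _ (ext_dp (2 * s) A hA) (ext_dm B hB)
    rw [sum_dite_eq_sum_fin (2 * s) (fun a ha => (fun i : Fin n => if hi : (i : ℕ) < n - 2 * s then dp (2 * s) A ⟨(i : ℕ), hi⟩ else 0) a *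
      ((fun i : Fin n => if hi : (i : ℕ) < n - s then dm s B ⟨(i : ℕ), hi⟩ else 0) ⟨(a : ℕ) + s, by omega⟩ *
       (fun i : Fin n => if hi : (i : ℕ) < n - s then dm s B ⟨(i : ℕ), hi⟩ else 0) a))] at h
    rw [dotProduct, ← h]
    refine Finset.sum_congr rfl fun i _ => ?_
    simp only [dif_pos (show (i : ℕ) < n - 2 * s from i.isLt), dif_pos (show (i : ℕ) + s < n - s by omega),
      dif_pos (show (i : ℕ) < n - s by omega)]
    ring
  -- (ii) `Q(q) = 0 ⇒ q = 0` (THEOREM B)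
  have hzero : ∀ q ∈ W.map (dm s), (∀ i : Fin (n - 2 * s), q ⟨(i : ℕ) + s, by omega⟩ * q ⟨(i : ℕ), by omega⟩ = 0) → q = 0 := by
    rintro _ ⟨B, hB, rfl⟩ hQ
    have h := pair_eq_zero_of_isNilpotent_band hs (fun _ => (1 : ℂ)) _ (fun b hb => by
      have := hQ ⟨(b : ℕ), by omega⟩
      simpa [dif_pos (show (b : ℕ) + s < n - s by omega), dif_pos (show (b : ℕ) < n - s by omega)] using this)
      (hW _ (W.add_mem hJs (ext_dm B hB)))
    funext i
    have hi := h ⟨(i : ℕ), by omega⟩ (by dsimp only; omega)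
    simpa [dif_pos i.isLt] using hi
  -- (iii) `dim N_s = 1`
  obtain ⟨i₀, hi₀⟩ : ∃ i₀, u i₀ ≠ 0 := by by_contra h; push Not at h; exact hu0 (funext h)
  have hdim : Module.finrank ℂ (W.map (dm s)) = 1 := by
    have h1 : 1 ≤ Module.finrank ℂ (W.map (dm s)) := by
      by_contra h0
      apply hne
      exact Submodule.finrank_eq_zero.1 (by omega)
    by_contra hne1
    obtain ⟨q, hq, hq0, hqi⟩ := exists_ne_zero_of_two_le_finrank (W.map (dm s)) (by omega) ⟨(i₀ : ℕ), by omega⟩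
    obtain ⟨t, ht⟩ := hQu q hq
    have hti : q ⟨(i₀ : ℕ) + s, by omega⟩ * q ⟨(i₀ : ℕ), by omega⟩ = t * u i₀ := by
      have := congr_fun ht i₀; simpa using this
    rw [hqi, mul_zero] at hti
    have ht0 : t = 0 := by
      rcases mul_eq_zero.1 hti.symm with h | h
      · exact h
      · exact absurd h hi₀
    apply hq0
    apply hzero q hq
    intro i
    have := congr_fun ht i
    simpa [ht0] using this
  -- the generator `y₀` and `P_s = y₀^⊥`
  obtain ⟨y₀, hy₀N, hy₀⟩ := Submodule.exists_mem_ne_zero_of_ne_bot hne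
  have hline : ∀ q ∈ W.map (dm s), ∃ t : ℂ, q = t • y₀ := by
    intro q hq
    have h1 := (finrank_eq_one_iff_of_nonzero' (⟨y₀, hy₀N⟩ : W.map (dm s)) (by
      intro h; apply hy₀; exact congrArg Subtype.val h)).1 hdim ⟨q, hq⟩
    obtain ⟨t, ht⟩ := h1
    exact ⟨t, by have := congrArg Subtype.val ht; simpa using this.symm⟩
  have hPs : ∀ x : Fin (n - s) → ℂ, x ⬝ᵥ y₀ = 0 → x ∈ W.map (dp s) := by
    intro x hx
    refine mem_of_dot_eq_zero (W.map (dm s)) (W.map (dp s)) (fun q hq p hp => by rw [dotProduct_comm]; exact hPNs p hp q hq)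
      (by omega) x (fun q hq => ?_)
    obtain ⟨t, rfl⟩ := hline q hq
    rw [dotProduct_smul, hx, smul_zero]
  -- (iv) two support indices of `y₀` differ by exactly `s`
  have htwo : ∀ i₁ i₂ : Fin (n - s), i₁ ≠ i₂ → y₀ i₁ ≠ 0 → y₀ i₂ ≠ 0 → (i₂ : ℕ) = (i₁ : ℕ) + s ∨ (i₁ : ℕ) = (i₂ : ℕ) + s := by
    intro i₁ i₂ hne12 h1 h2
    by_contra hcon
    push Not at hcon
    set x : Fin (n - s) → ℂ := (y₀ i₁)⁻¹ • Pi.single i₁ 1 - (y₀ i₂)⁻¹ • Pi.single i₂ 1 with hxdef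
    have hxy : x ⬝ᵥ y₀ = 0 := by
      rw [hxdef, sub_dotProduct, smul_dotProduct, smul_dotProduct, single_dotProduct, single_dotProduct, one_mul, one_mul,
        smul_eq_mul, smul_eq_mul, inv_mul_cancel₀ h1, inv_mul_cancel₀ h2, sub_self]
    obtain ⟨A, hA, hAx⟩ := hPs x hxy
    obtain ⟨B, hB, hBy⟩ : y₀ ∈ W.map (dm s) := hy₀N
    have hQ := sum_sq_add_two_mul_sum_eq_zero W hW s _ _ (ext_dp s A hA) (ext_dm B hB)
    rw [hAx, hBy] at hQ
    -- pointwise: the product vector is `e_{i₁} − e_{i₂}`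
    have hw : ∀ a : Fin n, (if (a : ℕ) + s < n then
        (fun i : Fin n => if hi : (i : ℕ) < n - s then x ⟨(i : ℕ), hi⟩ else 0) a *
        (fun i : Fin n => if hi : (i : ℕ) < n - s then y₀ ⟨(i : ℕ), hi⟩ else 0) a else 0) =
        (if (a : ℕ) = (i₁ : ℕ) then (1 : ℂ) else 0) - (if (a : ℕ) = (i₂ : ℕ) then (1 : ℂ) else 0) := by
      intro a
      by_cases ha : (a : ℕ) + s < n
      · rw [if_pos ha]; dsimp only
        rw [dif_pos (by omega), dif_pos (by omega), hxdef]
        simp only [Pi.sub_apply, Pi.smul_apply, Pi.single_apply, smul_eq_mul, Fin.ext_iff]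
        have hne' : (i₁ : ℕ) ≠ (i₂ : ℕ) := fun e => hne12 (Fin.ext e)
        by_cases ha1 : (a : ℕ) = (i₁ : ℕ)
        · simp only [ha1, hne', if_true, if_false]
          have : y₀ ⟨(i₁ : ℕ), by omega⟩ = y₀ i₁ := congrArg y₀ (Fin.ext rfl)
          rw [this]; simp [h1]
        · by_cases ha2 : (a : ℕ) = (i₂ : ℕ)
          · simp only [ha2, hne'.symm, if_true, if_false]
            have : y₀ ⟨(i₂ : ℕ), by omega⟩ = y₀ i₂ := congrArg y₀ (Fin.ext rfl)
            rw [this]; simp [h2]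
          · simp only [ha1, ha2, if_false]; ring
      · rw [if_neg ha, if_neg (by omega), if_neg (by omega), sub_zero]
    have hw' : ∀ a : Fin n, ∀ ha : (a : ℕ) + s < n,
        (fun i : Fin n => if hi : (i : ℕ) < n - s then x ⟨(i : ℕ), hi⟩ else 0) a *
        (fun i : Fin n => if hi : (i : ℕ) < n - s then y₀ ⟨(i : ℕ), hi⟩ else 0) a =
        (if (a : ℕ) = (i₁ : ℕ) then (1 : ℂ) else 0) - (if (a : ℕ) = (i₂ : ℕ) then (1 : ℂ) else 0) := by
      intro a ha; have := hw a; rwa [if_pos ha] at this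
    -- the squares sum to `2`, the shifted products vanish
    have hsq : ∀ a : Fin n, (if (a : ℕ) + s < n then
        (fun i : Fin n => if hi : (i : ℕ) < n - s then x ⟨(i : ℕ), hi⟩ else 0) a *
        (fun i : Fin n => if hi : (i : ℕ) < n - s then y₀ ⟨(i : ℕ), hi⟩ else 0) a else 0) ^ 2 =
        (if (a : ℕ) = (i₁ : ℕ) then (1 : ℂ) else 0) + (if (a : ℕ) = (i₂ : ℕ) then (1 : ℂ) else 0) := by
      intro a; rw [hw a]
      have : (i₁ : ℕ) ≠ (i₂ : ℕ) := fun e => hne12 (Fin.ext e)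
      split_ifs <;> first | (exfalso; omega) | norm_num
    have hpr : ∀ a : Fin n, (if ha : (a : ℕ) + 2 * s < n then
        (fun i : Fin n => if hi : (i : ℕ) < n - s then x ⟨(i : ℕ), hi⟩ else 0) a *
        (fun i : Fin n => if hi : (i : ℕ) < n - s then y₀ ⟨(i : ℕ), hi⟩ else 0) a *
        ((fun i : Fin n => if hi : (i : ℕ) < n - s then x ⟨(i : ℕ), hi⟩ else 0) ⟨(a : ℕ) + s, by omega⟩ *
         (fun i : Fin n => if hi : (i : ℕ) < n - s then y₀ ⟨(i : ℕ), hi⟩ else 0) ⟨(a : ℕ) + s, by omega⟩) else 0) = 0 := by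
      intro a
      by_cases ha : (a : ℕ) + 2 * s < n
      · rw [dif_pos ha, hw' a (by omega), hw' ⟨(a : ℕ) + s, by omega⟩ (by dsimp only; omega)]
        dsimp only
        have : (i₁ : ℕ) ≠ (i₂ : ℕ) := fun e => hne12 (Fin.ext e)
        split_ifs <;> first | (exfalso; omega) | norm_num
      · rw [dif_neg ha]
    rw [Finset.sum_congr rfl (fun a _ => hsq a), Finset.sum_congr rfl (fun a _ => hpr a), Finset.sum_const_zero, mul_zero, add_zero,
      Finset.sum_add_distrib, sum_ite_eq_val, sum_ite_eq_val, dif_pos (show (i₁ : ℕ) < n by omega), dif_pos (show (i₂ : ℕ) < n by omega)] at hQ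
    norm_num at hQ
  -- (v) the support of `y₀` is `{a, a+s}` with opposite values
  obtain ⟨a, ha0, hamin⟩ : ∃ a : Fin (n - s), y₀ a ≠ 0 ∧ ∀ j : Fin (n - s), y₀ j ≠ 0 → (a : ℕ) ≤ (j : ℕ) := by
    set T : Finset (Fin (n - s)) := Finset.univ.filter fun i : Fin (n - s) => y₀ i ≠ 0 with hTdef
    have memT : ∀ i, i ∈ T ↔ y₀ i ≠ 0 := fun i => by simp [hTdef]
    have hT : T.Nonempty := by
      by_contra h
      rw [Finset.not_nonempty_iff_eq_empty] at h
      apply hy₀; funext i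
      by_contra hi
      have := (memT i).2 hi
      rw [h] at this; simp at this
    refine ⟨T.min' hT, (memT _).1 (Finset.min'_mem T hT), fun j hj => ?_⟩
    exact Fin.le_def.1 (Finset.min'_le T j ((memT j).2 hj))
  have hsupp : ∀ j : Fin (n - s), y₀ j ≠ 0 → (j : ℕ) = (a : ℕ) ∨ (j : ℕ) = (a : ℕ) + s := by
    intro j hj
    by_cases hja : j = a
    · exact Or.inl (congrArg Fin.val hja)
    · rcases htwo a j (Ne.symm hja) ha0 hj with h | h
      · exact Or.inr h
      · have := hamin j hj; omega
  have hsum := hN1s y₀ hy₀N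
  rw [dotProduct] at hsum
  simp only [mul_one] at hsum
  -- `a + s` is a support index (else the sum would be `y₀ a ≠ 0`)
  have has : ∃ hlt : (a : ℕ) + s < n - s, y₀ ⟨(a : ℕ) + s, hlt⟩ = - y₀ a := by
    by_cases hlt : (a : ℕ) + s < n - s
    · have h2 : ∑ j : Fin (n - s), y₀ j = y₀ a + y₀ ⟨(a : ℕ) + s, hlt⟩ := by
        rw [← Finset.sum_subset (Finset.subset_univ ({a, ⟨(a : ℕ) + s, hlt⟩} : Finset (Fin (n - s))))]
        · rw [Finset.sum_pair]; intro h; have := congrArg Fin.val h; simp at this; omega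
        · intro j _ hj
          by_contra hj0
          rcases hsupp j hj0 with h | h
          · exact hj (by rw [Finset.mem_insert]; exact Or.inl (Fin.ext h))
          · exact hj (by rw [Finset.mem_insert, Finset.mem_singleton]; exact Or.inr (Fin.ext h))
      rw [h2] at hsum
      exact ⟨hlt, by linear_combination hsum⟩
    · exfalso
      have h2 : ∑ j : Fin (n - s), y₀ j = y₀ a := by
        rw [← Finset.sum_subset (Finset.subset_univ ({a} : Finset (Fin (n - s)))), Finset.sum_singleton]
        intro j _ hj
        by_contra hj0
        rcases hsupp j hj0 with h | h
        · exact hj (Finset.mem_singleton.2 (Fin.ext h))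
        · have := j.isLt; omega
      rw [h2] at hsum; exact ha0 hsum
  obtain ⟨hlt, hopp⟩ := has
  have ha2s : (a : ℕ) + 2 * s < n := by omega
  set t₀ : ℂ := y₀ a with ht₀
  have hy₀e : y₀ = t₀ • (Pi.single (⟨(a : ℕ), by omega⟩ : Fin (n - s)) (1 : ℂ) - Pi.single (⟨(a : ℕ) + s, by omega⟩ : Fin (n - s)) (1 : ℂ)) := by
    funext j
    simp only [Pi.smul_apply, Pi.sub_apply, Pi.single_apply, smul_eq_mul, Fin.ext_iff]
    by_cases hj0 : y₀ j = 0
    · rw [hj0]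
      by_cases hja : (j : ℕ) = (a : ℕ)
      · exfalso; exact ha0 (by rw [← hj0]; exact congrArg y₀ (Fin.ext hja.symm))
      · rw [if_neg hja]
        by_cases hjs : (j : ℕ) = (a : ℕ) + s
        · exfalso; apply ha0
          have : y₀ ⟨(a : ℕ) + s, by omega⟩ = 0 := by rw [← hj0]; exact congrArg y₀ (Fin.ext hjs.symm)
          rw [this] at hopp; linear_combination hopp
        · rw [if_neg hjs]; ring
    · rcases hsupp j hj0 with h | h
      · rw [if_pos h, if_neg (by omega), show j = a from Fin.ext h]; ring
      · rw [if_neg (by omega), if_pos h, show j = ⟨(a : ℕ) + s, by omega⟩ from Fin.ext h, hopp]; ring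
  refine ⟨(a : ℕ), ha2s, ?_, fun q hq => ?_⟩
  · have h := Submodule.smul_mem (W.map (dm s)) t₀⁻¹ hy₀N
    rw [hy₀e, smul_smul, inv_mul_cancel₀ ha0, one_smul] at h
    exact h
  · obtain ⟨t, rfl⟩ := hline q hq
    exact ⟨t * t₀, by rw [hy₀e, smul_smul]⟩

/-! ## The kill for `s ≥ 2` -/

/-- ★ **LEMMA R-b (iv), kernel form: for `s ≥ 2`, `e_a − e_{a+s} ∈ N_s` is impossible** (zero slack at height `1` gives the window vector
`C = 𝟙_{[a,a+s)} − 𝟙_{[a+s,a+2s)} ∈ N_1` by (T1); `T_{s+1} ⊆ W` gives the mixed word (T2) at `i = a+s−1`: `c_{a+s} C_{a+s−1} + C_{a+2s−1} c_{a+s−1} = −1 ≠ 0`).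
[memo §3 (iv); this seat] -/
theorem kill (W : Submodule ℂ (Matrix (Fin n) (Fin n) ℂ)) (hW : ∀ A ∈ W, IsNilpotent A)
    (hgr : ∀ A ∈ W, ∀ d : ℤ, (Matrix.of fun a b : Fin n => if (b : ℤ) - (a : ℤ) = d then A a b else 0) ∈ W)
    (dp dm : ∀ h : ℕ, Matrix (Fin n) (Fin n) ℂ →ₗ[ℂ] (Fin (n - h) → ℂ))
    (hdp : ∀ h A (i : Fin (n - h)) (a b : Fin n), (a : ℕ) = i → (b : ℕ) = i + h → dp h A i = A a b)
    (hdm : ∀ h A (i : Fin (n - h)) (a b : Fin n), (a : ℕ) = i + h → (b : ℕ) = i → dm h A i = A a b)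
    (hJ : (Matrix.of fun a b : Fin n => if (b : ℕ) = (a : ℕ) + 1 then (1 : ℂ) else 0) ∈ W)
    {s : ℕ} (hs : 2 ≤ s) (a : ℕ) (ha : a + 2 * s < n)
    (hmem : (Pi.single (⟨a, by omega⟩ : Fin (n - s)) (1 : ℂ) - Pi.single (⟨a + s, by omega⟩ : Fin (n - s)) (1 : ℂ)) ∈ W.map (dm s))
    (hPN1 : ∀ q ∈ W.map (dm 1), ∀ p ∈ W.map (dp 1), q ⬝ᵥ p = 0)
    (gsum1 : Module.finrank ℂ (W.map (dp 1)) + Module.finrank ℂ (W.map (dm 1)) = n - 1)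
    (hTs1 : ∀ i : ℕ, i + (s + 1) < n → (Matrix.of fun a b : Fin n => if (a : ℕ) = i ∧ (b : ℕ) = i + (s + 1) then (1 : ℂ) else 0) ∈ W) :
    False := by
  classical
  obtain ⟨B, hB, hBe⟩ := hmem
  set c : Fin n → ℂ := fun i => if (i : ℕ) = a then 1 else if (i : ℕ) = a + s then -1 else 0 with hcdef
  have hY : (Matrix.of fun p q : Fin n => if (p : ℕ) = (q : ℕ) + s then c q else 0) ∈ W := by
    refine lower_band_mem W hgr s (dm s) (hdm s) B hB c (fun i => ?_)
    rw [hBe, hcdef]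
    simp only [Pi.sub_apply, Pi.single_apply, Fin.ext_iff]
    have hs0 : s ≠ 0 := by omega
    by_cases hia : (i : ℕ) = a
    · simp [hia, hs0]
    · by_cases hib : (i : ℕ) = a + s
      · simp [hib, hs0]
      · simp [hia, hib]
  have hC := window_lower_mem W hW hgr (dp 1) (dm 1) (hdp 1) (hdm 1) hPN1 gsum1 hJ s c hY
  set C : Fin n → ℂ := fun k => ∑ i : Fin n, if (i : ℕ) ≤ (k : ℕ) ∧ (k : ℕ) < (i : ℕ) + s ∧ (i : ℕ) + s < n then c i else 0 with hCdef
  have hCk : ∀ k : Fin n, C k = (if a ≤ (k : ℕ) ∧ (k : ℕ) < a + s then (1 : ℂ) else 0) -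
      (if a + s ≤ (k : ℕ) ∧ (k : ℕ) < a + s + s then (1 : ℂ) else 0) := by
    intro k
    rw [hCdef]; dsimp only
    have e : ∀ i : Fin n, (if (i : ℕ) ≤ (k : ℕ) ∧ (k : ℕ) < (i : ℕ) + s ∧ (i : ℕ) + s < n then c i else 0) =
        (if (i : ℕ) = a then (if a ≤ (k : ℕ) ∧ (k : ℕ) < a + s then (1 : ℂ) else 0) else 0) -
        (if (i : ℕ) = a + s then (if a + s ≤ (k : ℕ) ∧ (k : ℕ) < a + s + s then (1 : ℂ) else 0) else 0) := by
      intro i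
      rw [hcdef]; dsimp only
      by_cases hia : (i : ℕ) = a
      · rw [if_pos hia, if_pos hia, if_neg (show ¬ ((i : ℕ) = a + s) by omega), sub_zero]
        have h' : a + s < n := by omega
        simp only [hia, h', and_true]
      · rw [if_neg hia, if_neg hia, zero_sub]
        by_cases hib : (i : ℕ) = a + s
        · rw [if_pos hib, if_pos hib]
          have h' : a + s + s < n := by omega
          simp only [hib, h', and_true]
          split_ifs <;> simp
        · rw [if_neg hib, if_neg hib, neg_zero]; split_ifs <;> rfl
    rw [Finset.sum_congr rfl (fun i _ => e i), Finset.sum_sub_distrib, sum_ite_eq_val, sum_ite_eq_val, dif_pos (by omega), dif_pos (by omega)]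
  -- (T2) at `i = a + s − 1`
  have hi : a + s - 1 + (s + 1) < n := by omega
  have hE := hTs1 (a + s - 1) hi
  have eU : (Matrix.of fun p q : Fin n => if (p : ℕ) = a + s - 1 ∧ (q : ℕ) = a + s - 1 + (s + 1) then (1 : ℂ) else 0) =
      Matrix.of fun p q : Fin n => if (q : ℕ) = (p : ℕ) + (s + 1) then
        (fun p : Fin n => if (p : ℕ) = a + s - 1 then (1 : ℂ) else 0) p else 0 := by
    ext p q; simp only [Matrix.of_apply]
    by_cases hp : (p : ℕ) = a + s - 1
    · by_cases hq : (q : ℕ) = (p : ℕ) + (s + 1)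
      · rw [if_pos ⟨hp, by omega⟩, if_pos hq, if_pos hp]
      · rw [if_neg (fun h' => hq (by omega)), if_neg hq]
    · rw [if_neg (fun h' => hp h'.1)]; split_ifs <;> rfl
  rw [eU] at hE
  have h := mixed_word W hW s _ c C hE hY hC
  rw [Finset.sum_eq_single ⟨a + s - 1, by omega⟩ (fun i _ hi' => by
      have : ¬ ((i : ℕ) = a + s - 1) := fun e => hi' (Fin.ext e)
      simp [this]) (fun h' => absurd (Finset.mem_univ _) h')] at h
  simp only [dif_pos hi, if_true] at h
  have hc1 : c ⟨a + s - 1 + 1, by omega⟩ = -1 := by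
    rw [hcdef]; dsimp only
    rw [if_neg (show ¬ (a + s - 1 + 1 = a) by omega), if_pos (show a + s - 1 + 1 = a + s by omega)]
  have hc2 : c ⟨a + s - 1, by omega⟩ = 0 := by
    rw [hcdef]; dsimp only
    rw [if_neg (show ¬ (a + s - 1 = a) by omega), if_neg (show ¬ (a + s - 1 = a + s) by omega)]
  have hC1 : C ⟨a + s - 1, by omega⟩ = 1 := by
    rw [hCk]; dsimp only
    rw [if_pos (show a ≤ a + s - 1 ∧ a + s - 1 < a + s from ⟨by omega, by omega⟩),
      if_neg (show ¬ (a + s ≤ a + s - 1 ∧ a + s - 1 < a + s + s) by omega)]; norm_num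
  have hC2 : C ⟨a + s - 1 + s, by omega⟩ = -1 := by
    rw [hCk]; dsimp only
    rw [if_neg (show ¬ (a ≤ a + s - 1 + s ∧ a + s - 1 + s < a + s) by omega),
      if_pos (show a + s ≤ a + s - 1 + s ∧ a + s - 1 + s < a + s + s from ⟨by omega, by omega⟩)]; norm_num
  rw [hc1, hc2, hC1, hC2] at h
  norm_num at h

end Summit.ValiantsHypothesis.ValiantsHypothesis.Theorems.GrenetZeon.HeavyTopThmCLemmaRb

end
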